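import Literature.MathematicalPhysics.QuantumFieldTheory.Balaban1983to89.Beta.ResolventCompositionStepB
import Summits.QuantumFields.BalabanUV.Beta.FP.PerfectObjects

/-!
# `BalabanUV.Beta.FP.PerfectTelescopingFinite` — road «FP» for binder row D1, leaf N7 ∕ sub-row **MS-1-FIN**: THE EXACT TWO-LEVEL
# (TRANSVERSE) TELESCOPING OF THE (j, m)-RESOLVENT FAMILY AT FINITE `j` — an5's `k1aTrans (j+m)` READ ON THE STEP-`j` LATTICE

HONEST FRAMING (cell contract, verbatim): «discharging `BetaPertH` makes Bałaban's UV stability UNCONDITIONAL — a real constructive-QFT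
result; it is NOT the continuum limit and NOT the Clay problem.»  HONEST DEPENDENCY (verbatim): «continuum YM on T⁴ ⇐ BetaPertH ∧ nine
spine estimates (0/9 proved); BetaPertH ⇐ (D1) ∧ (D4) ∧ CAP+tail; G-an2-4 gates asym, D1 and NE2/3/4.»  THIS MODULE DISCHARGES NOTHING of
the wall: it is [folklore] kernel bookkeeping (finite sums, block regrouping of finitely supported lattice sums) composed BY NAME from
LANDED modules — an5's `ResolventCompositionStepB.k1aTrans` ∕ `tsum_pair_eq_sum` ∕ `exists_support_finset` ∕ `dec_inl_inl`,
`ResolventComposition.codiff₁_contourSumAdj`, `KKTFluctuationEnergy.contourSumAdj_eq` ∕ `tsum_shift` ∕ `tsum_blocks` ∕ `quo_zsmul_add_toSite`,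
`StepDriftWitness.legPt_inl_eq`, `BlochFibreMatrix.eq_repZ_add_zsmul_quo`, and road FP's `PerfectObjects.KTot` (p207092).  No `def`, no
`Prop` minted, nothing cited, no hypothesis is a printed statement, 0 sorry.  0 wall binders; NOT `hasym`, NOT D1, NOT `BetaPertH`, NOT
continuum, NOT Clay.

ABSOLUTE RULE (cell charter, verbatim): «No internally-minted statement may enter as a cited fact. Every hypothesis is either kernel-proved
in this package or a verbatim quotation of a PUBLISHED theorem with page reference. The manuscript(s) under audit are NOT citable for their
own disputed steps — they are the thing under adjudication; programme-internal (2001/route/tribunal) claims are never citable.»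

WHY (road FP owner d1-p3-g3's N7 PLAN v1, `HOME/b2b-balaban-beta-d1-p3/N7-PROOF.v1.md` §2 (MS-1) «EXACT TELESCOPING AT THE FIXED POINT:
Γ_{Lc^{m+1}} = Γ_{Lc^m} + H_{Lc^m} C^{[Lc^m]} H_{Lc^m}ᵀ … SUPPLIERS: the finite-j two-level resolvent identities (an5 `ResolventComposition`
K1b′∕K1cNeg∕K1aTrans …), stationarity N1, entrywise limits»; `LEAVES-FP.md` row N7∕MS-1, sub-row MS-1-FIN).  The perfect resolvent of the
`m`-fold step is `KPerf Lc sf sm m = limMKerOf (j ↦ unitK (sf j) (sm j) (KTot (Lc^(j+m)) (Lc^j)))` (`FP/PerfectObjectsT`), the entrywise limit of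
the unit-rescaled (j, m)-RESOLVENTS `KTot (Lc^(j+m)) (Lc^j) = dec (Lc^j) (KInv (Lc^(j+m)))` (`FP/PerfectObjects`).  This file supplies the
FINITE-`j` content of (MS-1) on the K-side, in the only form in which it is true in the axial slice — an5's TRANSVERSE form (pairings
with finitely supported CO-CLOSED test 1-forms; the entrywise form `K1aNeg` is false for `j ≥ 1`, `ResolventComposition` §4): an5's
`k1aTrans (j+m)` compares `KInv (Lc^(j+m+1))` with `KInv (Lc^(j+m))` on FINE co-closed test forms; evaluating it at the LIFTED test forms
`𝒬ᵀ_{Lc^j} G` (`contourSumAdj`, co-closed whenever `G` is — `codiff₁_contourSumAdj`) and reading each fine pairing as a step-`j` pairing of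
the `Lc^j`-DECIMATED kernel (the dec-adjunction `pair_contourSumAdj_eq_pair_dec`, true for EVERY kernel) gives the identity for the (j, m+1)-
and (j, m)-members with the composite still in lifted fine form (`kTot_pair_telescoping`).  Reading the decimated composite as the step-`j`
composite `KTot_{j,m} ∘ liftW (Lc^m) ∘ KTot_{j,m}` through THE NEXT ONE STEP `KInvStep Lc (j+m)` (times `((Lc^j)^(d+2))²`, the factor the road's
units absorb) is the companion module `FP/PerfectTelescopingFiniteComposite`; the passage `j → ∞` (MS-1 proper) is NOT done here.

CONTENT (all [folklore]; general `d`, any `Lc ≥ 1`).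
* §1 `bshift_eq_zsmul_unitVec`, `contourSumAdj_eq_sum_bshift`, `exists_support_contourSumAdj` (the lift of a finitely supported coarse form is
  finitely supported — explicit finite carrier), `support_contourSumAdj_finite`, `codiff₁_contourSumAdj_eq_zero` (co-closedness transfers).
* §2 `tsum_mul_contourSum_of_finite` (the dec-adjunction on ONE leg for an ARBITRARY weight against a FINITELY SUPPORTED coarse form — the
  finite-support twin of an4's `DecLiftAdjoint.tsum_mul_contourSum`), `dec_sub`, **`pair_contourSumAdj_eq_pair_dec`** (for EVERY kernel `K`:
  `⟨𝒬ᵀG, K_ff 𝒬ᵀG′⟩_fine = ((M^(d+2))²) · ⟨G, (dec M K)_ff G′⟩_coarse`).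
* §3 **`kTot_pair_telescoping`** — THE FINITE-LEVEL (MS-1), K-side, transverse: for finitely supported co-closed `G, G′` on the step-`j` lattice,
  `⟨G, [KTot (Lc^(j+m+1)) (Lc^j)]_ff G′⟩ = ⟨G, ([KTot (Lc^(j+m)) (Lc^j)] − dec (Lc^j) [KInv_{Lc^(j+m)} ∘ liftW (Lc^(j+m)) true true (KInvStep Lc (j+m)) ∘ KInv_{Lc^(j+m)}])_ff G′⟩`.
Unit `b2b-balaban-gan24-formalise-leaf-05` (gen 33; cross-lane idle G-an2-4 swarm leaf seat on road FP's sub-row MS-1-FIN).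
-/

noncomputable section

namespace Summit.QuantumFields.BalabanUV.Beta.FP.PerfectTelescopingFinite

open Finset
open scoped BigOperators
open Literature.Probability.LatticeModels (TorusSite Torus.proj)
open Literature.MathematicalPhysics.QuantumFieldTheory.Balaban1983to89
open Literature.MathematicalPhysics.QuantumFieldTheory.Balaban1983to89.Beta
open AffineAveraging (Form1 codiff₁ unitVec unitVec_apply box toSite)
open AffineReproduction (contourSumAdj)
open Literature.MathematicalPhysics.QuantumFieldTheory.LatticeForm (repZ quo)
open ExpKernelCalculus (MKer comp)
open OneStepResolventKernel (Fib KInv)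
open OneStepKernelFamily (dec legPt legW legSet LegIdx KInvStep)
open InterLevelTransport (liftW)
open KKTFluctuationEnergy (contourSumAdj_eq tsum_shift tsum_blocks quo_zsmul_add_toSite)
open BlochFibreMatrix (eq_repZ_add_zsmul_quo)
open BalabanCompositeJets (bshift)
open StepDriftWitness (legPt_inl_eq)
open ResolventComposition (K1aTrans codiff₁_contourSumAdj)
open ResolventCompositionStepB (k1aTrans dec_inl_inl tsum_pair_eq_sum exists_support_finset)
open Summit.QuantumFields.BalabanUV.Beta.FP.PerfectObjects (KTot KTot_def)

variable {d : ℕ}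

/-! ## §1 Lifted test forms: the contour-sum adjoint of a finitely supported coarse 1-form -/

/-- [folklore] The contour-step offset of `BalabanCompositeJets` is `s • e_κ`. -/
theorem bshift_eq_zsmul_unitVec (κ : Fin (d + 1)) (s : ℕ) : bshift d κ s = (s : ℤ) • unitVec κ := by
  funext j
  simp only [bshift, Pi.smul_apply, unitVec_apply, smul_eq_mul, mul_ite, mul_one, mul_zero]

/-- [folklore] `𝒬ᵀ_M G (κ, x) = Σ_{s<M} G κ (quo M (x − bshift κ s))`. -/
theorem contourSumAdj_eq_sum_bshift (M : ℕ) (G : Form1 (d + 1) ℝ) (κ : Fin (d + 1)) (x : Fin (d + 1) → ℤ) :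
    contourSumAdj M G κ x = ∑ s ∈ Finset.range M, G κ (quo M (x - bshift d κ s)) := by
  rw [contourSumAdj_eq]
  simp only [bshift_eq_zsmul_unitVec]

/-- [folklore] **THE LIFT OF A FINITELY SUPPORTED COARSE FORM IS FINITELY SUPPORTED**, with an explicit finite carrier: if `G` vanishes off
the finset `s`, then `𝒬ᵀ_M G` vanishes off the fine points `repZ z + M•y + bshift κ t` (`y ∈ s`, `z` a box representative, `t < M`, any `κ`). -/
theorem exists_support_contourSumAdj (M : ℕ) [NeZero M] (G : Form1 (d + 1) ℝ) (s : Finset (Fin (d + 1) → ℤ))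
    (hs : ∀ κ y, y ∉ s → G κ y = 0) :
    ∃ S : Finset (Fin (d + 1) → ℤ), ∀ κ x, x ∉ S → contourSumAdj M G κ x = 0 := by
  classical
  refine ⟨((Finset.univ : Finset (Fin (d + 1))) ×ˢ ((s ×ˢ Finset.range M) ×ˢ (Finset.univ : Finset (TorusSite (d + 1) M)))).image
      (fun p => repZ p.2.2 + (M : ℤ) • p.2.1.1 + bshift d p.1 p.2.1.2), fun κ x hx => ?_⟩
  rw [contourSumAdj_eq_sum_bshift]
  refine Finset.sum_eq_zero fun t ht => ?_
  by_contra hne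
  have hy : quo M (x - bshift d κ t) ∈ s := by
    by_contra hy
    exact hne (hs κ _ hy)
  apply hx
  refine Finset.mem_image.mpr ⟨(κ, ((quo M (x - bshift d κ t), t), Torus.proj M (x - bshift d κ t))), ?_, ?_⟩
  · simp only [Finset.mem_product, Finset.mem_univ, true_and, and_true]
    exact ⟨hy, ht⟩
  · have h := eq_repZ_add_zsmul_quo (N := M) (x - bshift d κ t)
    rw [← h]
    abel

/-- [folklore] Finite support of the lift, componentwise (the shape an5's `K1aTrans` asks for). -/
theorem support_contourSumAdj_finite (M : ℕ) [NeZero M] (G : Form1 (d + 1) ℝ) (hG : ∀ κ, (Function.support (G κ)).Finite)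
    (κ : Fin (d + 1)) : (Function.support (contourSumAdj M G κ)).Finite := by
  obtain ⟨s, hs⟩ := exists_support_finset G hG
  obtain ⟨S, hS⟩ := exists_support_contourSumAdj M G s hs
  refine (Finset.finite_toSet S).subset fun x hx => ?_
  by_contra hxS
  exact hx (hS κ x (by simpa using hxS))

/-- [folklore] **CO-CLOSEDNESS TRANSFERS TO THE LIFT**: `codiff₁ G = 0 ⇒ codiff₁ (𝒬ᵀ_M G) = 0` (`ResolventComposition.codiff₁_contourSumAdj`:
`codiff₁ (𝒬ᵀ_M G) x = codiff₁ G (quo M x)`). -/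
theorem codiff₁_contourSumAdj_eq_zero (M : ℕ) [NeZero M] (G : Form1 (d + 1) ℝ) (hco : codiff₁ G = 0) :
    codiff₁ (contourSumAdj M G) = 0 := by
  funext x
  rw [codiff₁_contourSumAdj (N := M) G x, hco]
  rfl

/-! ## §2 The dec-adjunction: fine pairings of lifted forms are coarse pairings of the decimated kernel -/

/-- [folklore] The points of one `quo`-fibre (shifted by `v`) lie in a finite set: `{u : quo M (u − v) = y} ⊆ {repZ z + M•y + v}`. -/
theorem finite_fibre_quo (M : ℕ) [NeZero M] (v y : Fin (d + 1) → ℤ) :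
    {u : Fin (d + 1) → ℤ | quo M (u - v) = y}.Finite := by
  refine (Set.finite_range fun z : TorusSite (d + 1) M => repZ z + (M : ℤ) • y + v).subset fun u hu => ?_
  have h := eq_repZ_add_zsmul_quo (N := M) (u - v)
  rw [Set.mem_setOf_eq.mp hu] at h
  refine ⟨Torus.proj M (u - v), ?_⟩
  show repZ (Torus.proj M (u - v)) + (M : ℤ) • y + v = u
  rw [← h, sub_add_cancel]

/-- [folklore] **THE DEC-ADJUNCTION ON ONE LEG, FINITE-SUPPORT FORM** (twin of an4's `DecLiftAdjoint.tsum_mul_contourSum` with the roles of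
the hypotheses swapped: the weight `c` is ARBITRARY, the coarse function `A` is FINITELY SUPPORTED, so every sum is a finite sum):
`Σ'_u c u · Σ_{s<M} A (quo M (u − bshift κ s)) = Σ'_y (Σ_{i ∈ LegIdx} c (legPt M (inl κ) y i)) · A y` — the bijection
`(u, s) ↔ (y, (b, s))`, `u = M•y + b + s e_κ`. -/
theorem tsum_mul_contourSum_of_finite (c A : (Fin (d + 1) → ℤ) → ℝ) (hA : (Function.support A).Finite) (M : ℕ) [NeZero M]
    (κ : Fin (d + 1)) :
    ∑' u, c u * ∑ s ∈ Finset.range M, A (quo M (u - bshift d κ s))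
      = ∑' y, (∑ i ∈ LegIdx d M, c (legPt M (Sum.inl κ : Fib d) y i)) * A y := by
  classical
  -- (S1) each shifted term is finitely supported, hence summable
  have S1 : ∀ s : ℕ, Summable fun u => c u * A (quo M (u - bshift d κ s)) := fun s => by
    refine summable_of_hasFiniteSupport ((hA.preimage' fun y _ => finite_fibre_quo M (bshift d κ s) y).subset fun u hu => ?_)
    rw [Function.mem_support] at hu
    exact Set.mem_preimage.mpr (Function.mem_support.mpr (right_ne_zero_of_mul hu))
  -- (S2) after the shift `u = v + s e_κ`
  have S2 : ∀ s : ℕ, Summable fun v => c (v + bshift d κ s) * A (quo M v) := fun s => by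
    have h := (Equiv.addRight (bshift d κ s)).summable_iff.mpr (S1 s)
    refine h.congr fun v => ?_
    simp only [Function.comp_apply, Equiv.coe_addRight, add_sub_cancel_right]
  -- (S3) the block-regrouped coarse family is finitely supported
  have S3 : ∀ s : ℕ, Summable fun y => (∑ b ∈ box (d + 1) M, c ((M : ℤ) • y + toSite b + bshift d κ s)) * A y :=
    fun s => summable_of_hasFiniteSupport (hA.subset fun y hy => Function.mem_support.mpr
      (right_ne_zero_of_mul (Function.mem_support.mp hy)))
  have Hshift : ∀ s : ℕ, ∑' u, c u * A (quo M (u - bshift d κ s)) = ∑' v, c (v + bshift d κ s) * A (quo M v) := fun s => by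
    have h := tsum_shift (fun u => c u * A (quo M (u - bshift d κ s))) (bshift d κ s)
    simp only [add_sub_cancel_right] at h
    exact h.symm
  have Hblock : ∀ s : ℕ, ∑' v, c (v + bshift d κ s) * A (quo M v)
      = ∑' y, (∑ b ∈ box (d + 1) M, c ((M : ℤ) • y + toSite b + bshift d κ s)) * A y := fun s => by
    rw [tsum_blocks (N := M) (S2 s)]
    refine tsum_congr fun y => ?_
    rw [Finset.sum_mul]
    refine Finset.sum_congr rfl fun b hb => ?_
    rw [quo_zsmul_add_toSite y hb]
  calc ∑' u, c u * ∑ s ∈ Finset.range M, A (quo M (u - bshift d κ s))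
      = ∑' u, ∑ s ∈ Finset.range M, c u * A (quo M (u - bshift d κ s)) := tsum_congr fun u => Finset.mul_sum _ _ _
    _ = ∑ s ∈ Finset.range M, ∑' u, c u * A (quo M (u - bshift d κ s)) := Summable.tsum_finsetSum fun s _ => S1 s
    _ = ∑ s ∈ Finset.range M, ∑' y, (∑ b ∈ box (d + 1) M, c ((M : ℤ) • y + toSite b + bshift d κ s)) * A y :=
        Finset.sum_congr rfl fun s _ => by rw [Hshift s, Hblock s]
    _ = ∑' y, ∑ s ∈ Finset.range M, (∑ b ∈ box (d + 1) M, c ((M : ℤ) • y + toSite b + bshift d κ s)) * A y :=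
        (Summable.tsum_finsetSum fun s _ => S3 s).symm
    _ = ∑' y, (∑ i ∈ LegIdx d M, c (legPt M (Sum.inl κ : Fib d) y i)) * A y := by
        refine tsum_congr fun y => ?_
        rw [← Finset.sum_mul, LegIdx, Finset.sum_product_right]
        congr 1
        refine Finset.sum_congr rfl fun s _ => Finset.sum_congr rfl fun b _ => ?_
        rw [legPt_inl_eq, bshift_eq_zsmul_unitVec]

/-- [folklore] **THE DEC-ADJUNCTION FOR ONE LIFTED FORM**: for `G` finitely supported and ANY weight `c`,
`Σ'_u (𝒬ᵀ_M G)(κ, u) · c u = Σ'_y G κ y · Σ_{i ∈ LegIdx} c (legPt M (inl κ) y i)`. -/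
theorem tsum_contourSumAdj_mul (M : ℕ) [NeZero M] (G : Form1 (d + 1) ℝ) (hG : ∀ κ, (Function.support (G κ)).Finite)
    (c : (Fin (d + 1) → ℤ) → ℝ) (κ : Fin (d + 1)) :
    ∑' u, contourSumAdj M G κ u * c u = ∑' y, G κ y * ∑ i ∈ LegIdx d M, c (legPt M (Sum.inl κ : Fib d) y i) := by
  have h := tsum_mul_contourSum_of_finite c (G κ) (hG κ) M κ
  calc ∑' u, contourSumAdj M G κ u * c u
      = ∑' u, c u * ∑ s ∈ Finset.range M, G κ (quo M (u - bshift d κ s)) :=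
        tsum_congr fun u => by rw [contourSumAdj_eq_sum_bshift, mul_comm]
    _ = ∑' y, (∑ i ∈ LegIdx d M, c (legPt M (Sum.inl κ : Fib d) y i)) * G κ y := h
    _ = ∑' y, G κ y * ∑ i ∈ LegIdx d M, c (legPt M (Sum.inl κ : Fib d) y i) := tsum_congr fun y => mul_comm _ _

/-- [folklore] Decimation is linear: `dec M (K − K′) = dec M K − dec M K′`. -/
theorem dec_sub (M : ℕ) (K K' : MKer (d + 1) (Fib d)) : dec M (K - K') = dec M K - dec M K' := by
  funext x y a b
  simp only [dec, Pi.sub_apply, mul_sub, Finset.sum_sub_distrib]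

/-- [folklore] A finitely supported tsum pairing against ONE form is a finite sum. -/
theorem tsum_single_eq_sum (F : Form1 (d + 1) ℝ) (s : Finset (Fin (d + 1) → ℤ)) (hs : ∀ κ x, x ∉ s → F κ x = 0)
    (g : Fin (d + 1) → (Fin (d + 1) → ℤ) → ℝ) :
    (∑' x, ∑ κ, F κ x * g κ x) = ∑ x ∈ s, ∑ κ, F κ x * g κ x :=
  tsum_eq_sum (s := s) fun x hx => Finset.sum_eq_zero fun κ _ => by rw [hs κ x hx, zero_mul]

/-- [folklore] **THE DEC-ADJUNCTION FOR THE FIELD–FIELD BLOCK** — for EVERY kernel `K` and finitely supported coarse forms `G, G′`: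
`Σ'_x Σ'_y Σ_κ Σ_l (𝒬ᵀ_M G)(κ,x) K(x,y;inl κ,inl l) (𝒬ᵀ_M G′)(l,y) = ((M^(d+2))²) · Σ'_{x′} Σ'_{y′} Σ_κ Σ_l G(κ,x′) (dec M K)(x′,y′;inl κ,inl l) G′(l,y′)`
(both legs through `tsum_contourSumAdj_mul`; `dec_inl_inl` for the weights `M^{−(d+2)}` per field leg). -/
theorem pair_contourSumAdj_eq_pair_dec (M : ℕ) [NeZero M] (K : MKer (d + 1) (Fib d)) (G G' : Form1 (d + 1) ℝ)
    (hG : ∀ κ, (Function.support (G κ)).Finite) (hG' : ∀ κ, (Function.support (G' κ)).Finite) :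
    (∑' x, ∑' y, ∑ κ, ∑ l, contourSumAdj M G κ x * K x y (Sum.inl κ) (Sum.inl l) * contourSumAdj M G' l y)
      = (((M : ℝ) ^ (d + 2)) * ((M : ℝ) ^ (d + 2)))
        * ∑' x', ∑' y', ∑ κ, ∑ l, G κ x' * dec M K x' y' (Sum.inl κ) (Sum.inl l) * G' l y' := by
  classical
  obtain ⟨s, hs⟩ := exists_support_finset G hG
  obtain ⟨s', hs'⟩ := exists_support_finset G' hG'
  obtain ⟨S, hS⟩ := exists_support_contourSumAdj M G s hs
  obtain ⟨S', hS'⟩ := exists_support_contourSumAdj M G' s' hs'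
  have hM : ((M : ℝ) ^ (d + 2)) ≠ 0 := pow_ne_zero _ (by exact_mod_cast NeZero.ne M)
  -- the right leg, for a fixed fine left point
  have legR : ∀ (x : Fin (d + 1) → ℤ) (κ l : Fin (d + 1)),
      (∑' y, K x y (Sum.inl κ) (Sum.inl l) * contourSumAdj M G' l y)
        = ∑ y' ∈ s', G' l y' * ∑ i' ∈ LegIdx d M, K x (legPt M (Sum.inl l : Fib d) y' i') (Sum.inl κ) (Sum.inl l) := by
    intro x κ l
    have h := tsum_contourSumAdj_mul M G' hG' (fun y => K x y (Sum.inl κ) (Sum.inl l)) l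
    rw [show (∑' y, K x y (Sum.inl κ) (Sum.inl l) * contourSumAdj M G' l y) = ∑' y, contourSumAdj M G' l y * K x y (Sum.inl κ) (Sum.inl l)
      from tsum_congr fun y => mul_comm _ _, h]
    exact tsum_eq_sum (s := s') fun y' hy' => by rw [hs' l y' hy', zero_mul]
  -- the left leg, for a fixed coarse right datum
  have legL : ∀ (κ : Fin (d + 1)) (g : (Fin (d + 1) → ℤ) → ℝ),
      (∑' x, contourSumAdj M G κ x * g x) = ∑ x' ∈ s, G κ x' * ∑ i ∈ LegIdx d M, g (legPt M (Sum.inl κ : Fib d) x' i) := by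
    intro κ g
    rw [tsum_contourSumAdj_mul M G hG g κ]
    exact tsum_eq_sum (s := s) fun x' hx' => by rw [hs κ x' hx', zero_mul]
  -- LEFT side: peel the sums
  have L1 : (∑' x, ∑' y, ∑ κ, ∑ l, contourSumAdj M G κ x * K x y (Sum.inl κ) (Sum.inl l) * contourSumAdj M G' l y)
      = ∑' x, ∑ κ, contourSumAdj M G κ x * ∑ l, ∑ y' ∈ s', G' l y'
          * ∑ i' ∈ LegIdx d M, K x (legPt M (Sum.inl l : Fib d) y' i') (Sum.inl κ) (Sum.inl l) := by
    refine tsum_congr fun x => ?_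
    have hy : ∀ κ l, Summable fun y => contourSumAdj M G κ x * K x y (Sum.inl κ) (Sum.inl l) * contourSumAdj M G' l y :=
      fun κ l => summable_of_ne_finset_zero (s := S') fun y hy => by rw [hS' l y hy, mul_zero]
    rw [Summable.tsum_finsetSum fun κ _ => summable_sum fun l _ => hy κ l]
    refine Finset.sum_congr rfl fun κ _ => ?_
    rw [Summable.tsum_finsetSum fun l _ => hy κ l, Finset.mul_sum]
    refine Finset.sum_congr rfl fun l _ => ?_
    rw [← legR x κ l, ← tsum_mul_left]
    exact tsum_congr fun y => by ring
  rw [L1, tsum_single_eq_sum _ S hS]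
  -- RIGHT side: finite sums
  have R1 : (∑' x', ∑' y', ∑ κ, ∑ l, G κ x' * dec M K x' y' (Sum.inl κ) (Sum.inl l) * G' l y')
      = ∑ x' ∈ s, ∑ y' ∈ s', ∑ κ, ∑ l, G κ x' * dec M K x' y' (Sum.inl κ) (Sum.inl l) * G' l y' :=
    tsum_pair_eq_sum G G' s s' hs hs' fun x' y' κ l => dec M K x' y' (Sum.inl κ) (Sum.inl l)
  rw [R1]
  -- LEFT side as finite sums over `s`, via the left-leg adjunction applied to each `κ`
  have L2 : ∀ κ : Fin (d + 1), (∑ x ∈ S, contourSumAdj M G κ x * ∑ l, ∑ y' ∈ s', G' l y'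
        * ∑ i' ∈ LegIdx d M, K x (legPt M (Sum.inl l : Fib d) y' i') (Sum.inl κ) (Sum.inl l))
      = ∑ x' ∈ s, G κ x' * ∑ i ∈ LegIdx d M, ∑ l, ∑ y' ∈ s', G' l y'
        * ∑ i' ∈ LegIdx d M, K (legPt M (Sum.inl κ : Fib d) x' i) (legPt M (Sum.inl l : Fib d) y' i') (Sum.inl κ) (Sum.inl l) := by
    intro κ
    calc (∑ x ∈ S, contourSumAdj M G κ x * ∑ l, ∑ y' ∈ s', G' l y'
          * ∑ i' ∈ LegIdx d M, K x (legPt M (Sum.inl l : Fib d) y' i') (Sum.inl κ) (Sum.inl l))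
        = ∑' x, contourSumAdj M G κ x * ∑ l, ∑ y' ∈ s', G' l y'
            * ∑ i' ∈ LegIdx d M, K x (legPt M (Sum.inl l : Fib d) y' i') (Sum.inl κ) (Sum.inl l) :=
          (tsum_eq_sum (s := S) fun x hx => by rw [hS κ x hx, zero_mul]).symm
      _ = _ := legL κ fun x => ∑ l, ∑ y' ∈ s', G' l y'
            * ∑ i' ∈ LegIdx d M, K x (legPt M (Sum.inl l : Fib d) y' i') (Sum.inl κ) (Sum.inl l)
  rw [Finset.sum_comm]
  simp only [L2]
  -- the common canonical form: `Σ Σ Σ Σ (G κ x′ · B κ x′ y′ l) · G′ l y′` with `B` the double leg sum of `K`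
  have L3 : ∀ (κ : Fin (d + 1)) (x' : Fin (d + 1) → ℤ),
      G κ x' * ∑ i ∈ LegIdx d M, ∑ l, ∑ y' ∈ s', G' l y'
          * ∑ i' ∈ LegIdx d M, K (legPt M (Sum.inl κ : Fib d) x' i) (legPt M (Sum.inl l : Fib d) y' i') (Sum.inl κ) (Sum.inl l)
        = ∑ y' ∈ s', ∑ l, (G κ x' * ∑ i ∈ LegIdx d M, ∑ i' ∈ LegIdx d M,
            K (legPt M (Sum.inl κ : Fib d) x' i) (legPt M (Sum.inl l : Fib d) y' i') (Sum.inl κ) (Sum.inl l)) * G' l y' := by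
    intro κ x'
    calc G κ x' * ∑ i ∈ LegIdx d M, ∑ l, ∑ y' ∈ s', G' l y'
          * ∑ i' ∈ LegIdx d M, K (legPt M (Sum.inl κ : Fib d) x' i) (legPt M (Sum.inl l : Fib d) y' i') (Sum.inl κ) (Sum.inl l)
        = ∑ i ∈ LegIdx d M, ∑ l, ∑ y' ∈ s', G κ x' * (G' l y'
          * ∑ i' ∈ LegIdx d M, K (legPt M (Sum.inl κ : Fib d) x' i) (legPt M (Sum.inl l : Fib d) y' i') (Sum.inl κ) (Sum.inl l)) := by
          simp only [Finset.mul_sum]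
      _ = ∑ l, ∑ i ∈ LegIdx d M, ∑ y' ∈ s', G κ x' * (G' l y'
          * ∑ i' ∈ LegIdx d M, K (legPt M (Sum.inl κ : Fib d) x' i) (legPt M (Sum.inl l : Fib d) y' i') (Sum.inl κ) (Sum.inl l)) :=
          Finset.sum_comm
      _ = ∑ l, ∑ y' ∈ s', ∑ i ∈ LegIdx d M, G κ x' * (G' l y'
          * ∑ i' ∈ LegIdx d M, K (legPt M (Sum.inl κ : Fib d) x' i) (legPt M (Sum.inl l : Fib d) y' i') (Sum.inl κ) (Sum.inl l)) :=
          Finset.sum_congr rfl fun l _ => Finset.sum_comm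
      _ = ∑ y' ∈ s', ∑ l, ∑ i ∈ LegIdx d M, G κ x' * (G' l y'
          * ∑ i' ∈ LegIdx d M, K (legPt M (Sum.inl κ : Fib d) x' i) (legPt M (Sum.inl l : Fib d) y' i') (Sum.inl κ) (Sum.inl l)) :=
          Finset.sum_comm
      _ = ∑ y' ∈ s', ∑ l, (G κ x' * ∑ i ∈ LegIdx d M, ∑ i' ∈ LegIdx d M,
            K (legPt M (Sum.inl κ : Fib d) x' i) (legPt M (Sum.inl l : Fib d) y' i') (Sum.inl κ) (Sum.inl l)) * G' l y' := by
          refine Finset.sum_congr rfl fun y' _ => Finset.sum_congr rfl fun l _ => ?_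
          rw [Finset.mul_sum, Finset.sum_mul]
          exact Finset.sum_congr rfl fun i _ => by ring
  have R3 : ∀ (κ l : Fin (d + 1)) (x' y' : Fin (d + 1) → ℤ),
      (M : ℝ) ^ (d + 2) * (M : ℝ) ^ (d + 2) * (G κ x' * dec M K x' y' (Sum.inl κ) (Sum.inl l) * G' l y')
        = (G κ x' * ∑ i ∈ LegIdx d M, ∑ i' ∈ LegIdx d M,
            K (legPt M (Sum.inl κ : Fib d) x' i) (legPt M (Sum.inl l : Fib d) y' i') (Sum.inl κ) (Sum.inl l)) * G' l y' := by
    intro κ l x' y'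
    rw [dec_inl_inl]
    have e : (∑ i ∈ LegIdx d M, ∑ i' ∈ LegIdx d M, ((M : ℝ) ^ (d + 2))⁻¹ * ((M : ℝ) ^ (d + 2))⁻¹
          * K (legPt M (Sum.inl κ) x' i) (legPt M (Sum.inl l) y' i') (Sum.inl κ) (Sum.inl l))
        = ((M : ℝ) ^ (d + 2))⁻¹ * ((M : ℝ) ^ (d + 2))⁻¹ * ∑ i ∈ LegIdx d M, ∑ i' ∈ LegIdx d M,
          K (legPt M (Sum.inl κ) x' i) (legPt M (Sum.inl l) y' i') (Sum.inl κ) (Sum.inl l) := by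
      rw [Finset.mul_sum]
      exact Finset.sum_congr rfl fun i _ => by rw [Finset.mul_sum]
    rw [e]
    field_simp
  rw [show ((M : ℝ) ^ (d + 2) * (M : ℝ) ^ (d + 2)) * ∑ x' ∈ s, ∑ y' ∈ s', ∑ κ, ∑ l, G κ x' * dec M K x' y' (Sum.inl κ) (Sum.inl l) * G' l y'
      = ∑ x' ∈ s, ∑ y' ∈ s', ∑ κ, ∑ l, (M : ℝ) ^ (d + 2) * (M : ℝ) ^ (d + 2)
        * (G κ x' * dec M K x' y' (Sum.inl κ) (Sum.inl l) * G' l y') by simp only [Finset.mul_sum]]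
  simp only [R3, L3]
  -- reorder `Σ_κ Σ_{x′} Σ_{y′} Σ_l` into `Σ_{x′} Σ_{y′} Σ_κ Σ_l`
  calc ∑ κ, ∑ x' ∈ s, ∑ y' ∈ s', ∑ l, (G κ x' * ∑ i ∈ LegIdx d M, ∑ i' ∈ LegIdx d M,
            K (legPt M (Sum.inl κ : Fib d) x' i) (legPt M (Sum.inl l : Fib d) y' i') (Sum.inl κ) (Sum.inl l)) * G' l y'
      = ∑ x' ∈ s, ∑ κ, ∑ y' ∈ s', ∑ l, (G κ x' * ∑ i ∈ LegIdx d M, ∑ i' ∈ LegIdx d M,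
            K (legPt M (Sum.inl κ : Fib d) x' i) (legPt M (Sum.inl l : Fib d) y' i') (Sum.inl κ) (Sum.inl l)) * G' l y' :=
        Finset.sum_comm
    _ = ∑ x' ∈ s, ∑ y' ∈ s', ∑ κ, ∑ l, (G κ x' * ∑ i ∈ LegIdx d M, ∑ i' ∈ LegIdx d M,
            K (legPt M (Sum.inl κ : Fib d) x' i) (legPt M (Sum.inl l : Fib d) y' i') (Sum.inl κ) (Sum.inl l)) * G' l y' :=
        Finset.sum_congr rfl fun x' _ => Finset.sum_comm

/-! ## §3 The finite-level (MS-1) on the K-side: the (j, m)-resolvent family telescopes on transverse test forms -/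

/-- [folklore] **THE EXACT TWO-LEVEL TELESCOPING OF THE (j, m)-RESOLVENT FAMILY AT FINITE `j` (transverse form).**  For every
`Lc ≥ 1`, `j, m`, and all finitely supported CO-CLOSED test 1-forms `G, G′` on the step-`j` lattice,
`⟨G, [KTot (Lc^(j+m+1)) (Lc^j)]_ff G′⟩ = ⟨G, ([KTot (Lc^(j+m)) (Lc^j)] − dec (Lc^j) [KInv_{Lc^(j+m)} ∘ liftW (Lc^(j+m)) true true (KInvStep Lc (j+m)) ∘ KInv_{Lc^(j+m)}])_ff G′⟩`:
the field–field blocks of the (j, m+1)- and the (j, m)-resolvents of road FP (`PerfectObjects.KTot`) differ, on the physical (gauge-transverse)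
slice of the step-`j` lattice, EXACTLY by the `Lc^j`-decimation of an5's composite through THE NEXT ONE STEP `KInvStep Lc (j+m)` —
an5's `ResolventCompositionStepB.k1aTrans (j+m)` evaluated at the lifted test forms `𝒬ᵀ_{Lc^j} G`, `𝒬ᵀ_{Lc^j} G′` and read through
`pair_contourSumAdj_eq_pair_dec`.  (`m = 0`: an5's identity itself read through `dec (Lc^j)`.  The decimated composite is the step-`j`
composite `KTot_{j,m} ∘ liftW (Lc^m) ∘ KTot_{j,m}` times `((Lc^j)^(d+2))²` — companion module; the limit `j → ∞` in the road's units is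
MS-1 proper and is NOT claimed here.) -/
theorem kTot_pair_telescoping (Lc : ℕ) [NeZero Lc] (j m : ℕ) (G G' : Form1 (d + 1) ℝ)
    (hG : ∀ κ, (Function.support (G κ)).Finite) (hG' : ∀ κ, (Function.support (G' κ)).Finite)
    (hcoG : codiff₁ G = 0) (hcoG' : codiff₁ G' = 0) :
    (∑' x', ∑' y', ∑ κ, ∑ l, G κ x' * KTot (d := d) (Lc ^ (j + m + 1)) (Lc ^ j) x' y' (Sum.inl κ) (Sum.inl l) * G' l y')
      = ∑' x', ∑' y', ∑ κ, ∑ l, G κ x' *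
          (KTot (d := d) (Lc ^ (j + m)) (Lc ^ j) x' y' (Sum.inl κ) (Sum.inl l)
            - dec (Lc ^ j) (comp (KInv (N := Lc ^ (j + m)) (d := d))
                (comp (liftW (Lc ^ (j + m)) true true (KInvStep (d := d) Lc (j + m))) (KInv (N := Lc ^ (j + m)) (d := d))))
              x' y' (Sum.inl κ) (Sum.inl l)) * G' l y' := by
  haveI : NeZero (Lc ^ j) := ⟨pow_ne_zero _ (NeZero.ne Lc)⟩
  have hM : ((((Lc ^ j : ℕ) : ℝ) ^ (d + 2)) * (((Lc ^ j : ℕ) : ℝ) ^ (d + 2))) ≠ 0 := by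
    have h1 : (((Lc ^ j : ℕ) : ℝ) ^ (d + 2)) ≠ 0 := pow_ne_zero _ (by exact_mod_cast NeZero.ne (Lc ^ j))
    exact mul_ne_zero h1 h1
  -- an5's transverse telescoping at level `j + m`, at the lifted test forms
  have hK := (k1aTrans (d := d) Lc (j + m)) (contourSumAdj (Lc ^ j) G) (contourSumAdj (Lc ^ j) G')
    (support_contourSumAdj_finite (Lc ^ j) G hG) (support_contourSumAdj_finite (Lc ^ j) G' hG')
    (codiff₁_contourSumAdj_eq_zero (Lc ^ j) G hcoG) (codiff₁_contourSumAdj_eq_zero (Lc ^ j) G' hcoG')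
  -- read both sides on the step-`j` lattice
  rw [pair_contourSumAdj_eq_pair_dec (Lc ^ j) (KInv (N := Lc ^ (j + m + 1)) (d := d)) G G' hG hG'] at hK
  have hR := pair_contourSumAdj_eq_pair_dec (Lc ^ j)
    (KInv (N := Lc ^ (j + m)) (d := d) - comp (KInv (N := Lc ^ (j + m)) (d := d))
      (comp (liftW (Lc ^ (j + m)) true true (KInvStep (d := d) Lc (j + m))) (KInv (N := Lc ^ (j + m)) (d := d)))) G G' hG hG'
  simp only [Pi.sub_apply] at hR
  rw [hR, dec_sub] at hK
  simp only [Pi.sub_apply, KTot_def] at hK ⊢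
  exact mul_left_cancel₀ hM hK

end Summit.QuantumFields.BalabanUV.Beta.FP.PerfectTelescopingFinite

end
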